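import Summits.AtomisticToContinuum.Crystallization.Theorems.ChartedZeroExcessLayeredLatticeLiouvilleZZZYPA

/-!
# ChartedZeroExcess · LayeredLatticeLiouville ZZZYQA (lens-2 g96 «UBK♯» — the generic-side crux of record of UNIF-96, by NAME) — docket 26636, W2 line

Critic rows 1689–1691 promoted «UniformBarlowKorn» (uniform harmonic coercivity over ALL equilibrium stacking words) to the generic-side crux of
record and asked for its statement block.  IT IS ALREADY TYPED IN THE TREE: (U) `UniformEquilStability s Λ` (file R, lens-2 g30, critic row 525;
tame form (U♮) `UniformTameStability`, file S) — `∀ a > 0, ∃ κ₀ > 0, ∃ c₀ > 0, ∀ (L, w) equilibrium chart at scale a, ∃ re-indexing w' of the SAME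
layered set, c₀-co-Lipschitz ∧ CoerciveZ (layeredKernel (L t₁) (L t₂) w') κ₀` (the LJ bond Hessians `forceConst` WITH prestress, layer-local currency
`nnFormZ`, "periodic stacking word or not").  DEDUP: this file files NO new coercivity statement; it adds only the SCALE-UNIFORM, EXPLICIT-CONSTANT
reading the W2 leaves consume — (X1ᴸ′) `LabelTubeConvexityP … lam` and (GRᴸ) `LabelGreenResponseP … Γ` carry their constant IN FRONT of `∀ a > 0`,
(U) produces `κ₀(a)` behind it:
* `UniformEquilStabilityAt s Λ κ₀ c₀` := (U)'s body with `(κ₀, c₀)` as parameters and `∀ a > 0` inside (vacuous off the clean/Nash window, where no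
  equilibrium chart exists; desk KORN-96/ENERGY-96: geometric-currency κ = 1.10–1.24 over 11 words at NN distance 0.9718, 0.74–0.78 at NN 1 — positive
  across the admissible window, thinnest at its tensile end);
* PROVED: `uniformEquilStability_of_at` ((U♯) with positive constants ⇒ (U)), `UniformEquilStabilityAt.of_le` (antitone in κ₀, c₀).
The consumer «(U♯) → (T)-tail → ε-seam → (X1ᴸ′) lam(κ₀, c₀, Λ)» (ENERGY-ROUTE-96) is g97's typed lemma; nothing here claims it.
0 sorry · import = tree ZZZYPA · 1 def + 2 lemmas · no instances/notation/options · axioms standard. [g96]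
-/

noncomputable section

open scoped BigOperators
open MeasureTheory Set Metric Filter Topology

namespace Summit.AtomisticToContinuum.Crystallization.Theorems.ChartedZeroExcessLayeredLatticeLiouville

open Summit.AtomisticToContinuum.Crystallization.Theorems.ChartedPlanarOrderRigidityDoor (E3)
open Summit.AtomisticToContinuum.Crystallization.Theorems.ChartedPlanarOrderMesoCut (LayeredHom)
open Summit.AtomisticToContinuum.Crystallization.Theorems.ChartedPlanarOrderDoorLayered (Layered)
open Literature.MathematicalPhysics.StatisticalMechanics (triangularVec₁ triangularVec₂)

/-- ★★ **(U♯) «UniformEquilStabilityAt s Λ κ₀ c₀» — (U) `UniformEquilStability` WITH THE CONSTANTS IN FRONT OF THE SCALE**: every equilibrium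
`s`-chart `(L, w)` at ANY scale `a > 0` (`IsEquilChart a s Λ L w`) admits a re-indexing `w'` of its layered set (same point set, in-plane generators
`L t₁, L t₂`) that is `c₀`-co-Lipschitz and `κ₀`-coercive in the layer-local currency (`CoerciveZ (layeredKernel …) κ₀`, B/E verbatim).  The body is
(U)'s symbol for symbol; only the quantifier prefix differs (`κ₀ c₀ | ∀ a` instead of `∀ a, ∃ κ₀ c₀`), which is what a leaf constant standing in front
of `∀ a > 0` ((X1ᴸ′) `lam`, (GRᴸ) `Γ`) consumes.  Off the clean/Nash scale window no equilibrium chart exists and the clause is vacuous.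
STABILITY-type · UNDECIDED · TRUE-type-expected (KORN-96/ENERGY-96/WORD-96; census TAG 174 (a⁗)) · the generic-side crux of record of UNIF-96 (row 1691).
Why it might fail: as (U) — a soft collective interlayer-shear mode along a sequence of hollow stacking words (κ₀ ↓ 0) — PLUS degeneration at the
tensile edge of the admissible scale window (κ_geo = 0.78 at NN distance 1 against 1.24 at 0.9718), which (U) per scale would survive and (U♯) not.
Sources: tree R `UniformEquilStability` / S `UniformTameStability` (g30/g31); Hudson–Ortner doi:10.1051/m2an/2011014; M. Steinbach, On the Stability
of Objective Structures (Logos); memo NODE-g96 §2c (8)–(10), §4 (k). [g96] -/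
def UniformEquilStabilityAt (s Λ κ₀ c₀ : ℝ) : Prop :=
  ∀ a : ℝ, 0 < a →
    ∀ (L : E3 ≃L[ℝ] E3) (w : ℤ → E3), IsEquilChart a s Λ L w →
      ∃ w' : ℤ → E3,
        Layered ((L : E3 →L[ℝ] E3) (triangularVec₁ 1)) ((L : E3 →L[ℝ] E3) (triangularVec₂ 1)) w' = LayeredHom (L : E3 →L[ℝ] E3) w ∧
        IsLayeredCrystal c₀ ((L : E3 →L[ℝ] E3) (triangularVec₁ 1)) ((L : E3 →L[ℝ] E3) (triangularVec₂ 1)) w' ∧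
        CoerciveZ (layeredKernel ((L : E3 →L[ℝ] E3) (triangularVec₁ 1)) ((L : E3 →L[ℝ] E3) (triangularVec₂ 1)) w') κ₀

/-- PROVED: (U♯) with positive constants gives (U) `UniformEquilStability` (the tree's per-scale form, file R). [g96] -/
theorem uniformEquilStability_of_at {s Λ κ₀ c₀ : ℝ} (hκ : 0 < κ₀) (hc : 0 < c₀) (h : UniformEquilStabilityAt s Λ κ₀ c₀) :
    UniformEquilStability s Λ :=
  fun a ha => ⟨κ₀, hκ, c₀, hc, fun L w hLw => h a ha L w hLw⟩

/-- `CoerciveZ` is ANTITONE in the constant (the layer-local form `nnFormZ` is a `finsum` of squares, hence `≥ 0`). [g96] -/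
theorem CoerciveZ.of_le {K : Cell 2 → ℤ → ℤ → (E3 →L[ℝ] E3)} {κ κ' : ℝ} (hle : κ' ≤ κ) (h : CoerciveZ K κ) : CoerciveZ K κ' := by
  intro φ hφ E hE
  have hnn : 0 ≤ nnFormZ φ := finsum_nonneg fun x => by
    split_ifs <;> positivity
  exact (mul_le_mul_of_nonneg_right hle hnn).trans (h φ hφ E hE)

/-- `IsLayeredCrystal` is ANTITONE in the co-Lipschitz constant. [g96] -/
theorem IsLayeredCrystal.of_le {c c' : ℝ} {a b : E3} {w : ℤ → E3} (hle : c' ≤ c) (h : IsLayeredCrystal c a b w) :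
    IsLayeredCrystal c' a b w :=
  fun x y => (mul_le_mul_of_nonneg_right hle dist_nonneg).trans (h x y)

/-- PROVED: (U♯) is ANTITONE in both constants (a smaller `κ₀` or `c₀` is a weaker claim). [g96] -/
theorem UniformEquilStabilityAt.of_le {s Λ κ₀ c₀ κ₀' c₀' : ℝ} (hκ : κ₀' ≤ κ₀) (hc : c₀' ≤ c₀)
    (h : UniformEquilStabilityAt s Λ κ₀ c₀) : UniformEquilStabilityAt s Λ κ₀' c₀' := by
  intro a ha L w hLw
  obtain ⟨w', hset, hco, hcoer⟩ := h a ha L w hLw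
  exact ⟨w', hset, hco.of_le hc, hcoer.of_le hκ⟩

end Summit.AtomisticToContinuum.Crystallization.Theorems.ChartedZeroExcessLayeredLatticeLiouville

end
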